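import Literature.Probability.Percolation.ArmSeparationOutSlotsFour
import Literature.Probability.Percolation.ArmSeparationOutLanding
import HarnessLib

/-!
# The four-arm outer landing step: the supports of the open corridors avoid those of the closed ones

Topic `Literature/Probability/Percolation`; family `crit-perc` / near-critical percolation on `𝕋`.
A brick of the near-critical arm-separation theorem for four arms of alternating colours
(P. Nolin, *Near-critical percolation in two dimensions*, EJP 13 (2008), Thm. 11 for `j = 4`,
`σ = BWBW` [arXiv 0711.4948: Thm. 10]; H. Kesten, CMP 109 (1987), Lemmas 4–6), landing step of the
external extremities: the disjointness hypotheses of Nolin's generalised FKG inequality (Lemma 13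
[arXiv Lemma 12]: "three disjoint finite sets of vertices `𝒜`, `𝒜⁺`, `𝒜⁻`") for the slots of
`ArmSeparationOutSlotsFour.lean`. This is the four-arm analogue of the disjointness half of the
tree's `ArmSeparationOutLanding.lean`.

For a valid rung, a slot in range whose windows can hold middle tips, and the routing predicate
`RouteOK`:

* `disjoint_osharedFin_privE` — every private support lies beyond `Λ_{2M}`, off the shared support;
* `disjoint_privE` — the private support of an OPEN arm (`e = 0, 2`) is disjoint from that of a
  CLOSED arm (`e = 1, 3`). The sixteen pairs of pieces (near set, arc, approach box, target box of
  either arm) are separated by norm bands (near sets at depth `≤ 2k + L`, rings in disjoint bands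
  `(r - s - 2e, r + 2e]` `2μ` apart, approach boxes from `r - 2e` on, target boxes beyond `4M`), by
  sectors (`disjoint_sectorNear`), by the tip-window gap on a common frame, by the danger-zone
  condition on target rows, and — where a spoke or an approach tube crosses a ring — by the routing
  predicate, through the generic `ringTube_disjoint_of_lat` (a ring tube off the window of positions
  of a lateral range on a side avoids every set confined to that side's sector and lateral range).

Also: the bookkeeping between arc membership and ring positions (`exists_pos_of_mem_arc`,
`ringTube_mem_arc_of_inArc`) and between reading and absolute positions (`neg_mem_ringTube_box_iff`),
used again by the landing. Everything here is proved; no named facts are introduced.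

## References

* P. Nolin, Near-critical percolation in two dimensions, *Electron. J. Probab.* 13 (2008), §4.3
  Lemma 13, §4.4 (arXiv 0711.4948: Lemma 12; proof of Thm. 10, p. 12) [Nolin2008].
* H. Kesten, Scaling relations for 2D-percolation, *Comm. Math. Phys.* 109 (1987), Lemma 2, §2 [Kesten1987].

Tree: `ringTube`, `ringTube_bounds`, `ringSide_lt`, `pos_le_of_side_lat`, `getElem?_thinRing`,
`length_thinRing`, `halfTube` (`ArmSeparationRingIndex.lean`, `ArmSeparationSlotSep.lean`);
`arc`, `getElem?_arc`, `getElem_mem_arc`, `length_arc`; `sectorNear`, `lat`, `dep`,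
`disjoint_sectorNear`, `frameIso_mem_sectorNear_iff`, `lat_frameIso`, `dep_frameIso`,
`dep_le_triNorm`; `onearSet`, `exists_of_mem_onearSet`, `norm_of_mem_onearSet`,
`onearSet_disjoint_onearSet`, `exists_of_mem_image_ospokeBox`, `idx_le_succ_of_le_add`,
`idx_le_succ_of_lt` (`ArmSeparationOutLanding.lean`); `piecePos`, `latIdx`, `latIdx_spec`,
`latIdx_lt`, `latIdx_mono`, `blockOff`; `OParams.Valid` facts; `Slot4` and `RouteOK`.
-/

noncomputable section

open Set

namespace Literature.Probability.Percolation

open LatticeModels Tube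

/-! ### Arcs and ring positions -/

/-- Modular bookkeeping: `((x + a) mod G + G - a) mod G = x` for `a, x < G`. [folklore] -/
theorem mod_add_sub_cancel {G a x : ℕ} (ha : a < G) (hx : x < G) : ((x + a) % G + G - a) % G = x := by
  by_cases h : x + a < G
  · rw [Nat.mod_eq_of_lt h, show x + a + G - a = x + G by omega, Nat.add_mod_right, Nat.mod_eq_of_lt hx]
  · have h1 : (x + a) % G = x + a - G := by rw [Nat.mod_eq_sub_mod (not_lt.1 h), Nat.mod_eq_of_lt (by omega)]
    rw [h1, show x + a - G + G - a = x by omega, Nat.mod_eq_of_lt hx]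

/-- Modular bookkeeping: `((g + G - a) mod G + a) mod G = g` for `a, g < G`. [folklore] -/
theorem mod_sub_add_cancel {G a g : ℕ} (ha : a < G) (hg : g < G) : ((g + G - a) % G + a) % G = g := by
  by_cases h : g + G - a < G
  · rw [Nat.mod_eq_of_lt h, show g + G - a + a = g + G by omega, Nat.add_mod_right, Nat.mod_eq_of_lt hg]
  · have h1 : (g + G - a) % G = g + G - a - G := by rw [Nat.mod_eq_sub_mod (not_lt.1 h), Nat.mod_eq_of_lt (by omega)]
    rw [h1, show g + G - a - G + a = g by omega, Nat.mod_eq_of_lt hg]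

/-- **The tubes of an arc, by position**: a tube of `arc (thinRing r e s) a len` (`a < 12n - 4`,
`len ≤ 12n - 4`, `1 ≤ n = r / s`) is `ringTube r e s g` for a position `g < 12n - 4` on the arc
(`InArc`). [folklore] -/
theorem exists_pos_of_mem_arc {r e s a len : ℕ} (hr : 1 ≤ r / s) (ha : a < 12 * (r / s) - 4) (hlen : len ≤ 12 * (r / s) - 4)
    {T : Tube} (hT : T ∈ arc (thinRing r e s) a len) :
    ∃ g, g < 12 * (r / s) - 4 ∧ InArc (12 * (r / s) - 4) a len g ∧ T = ringTube r e s g := by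
  have hG := length_thinRing (e := e) hr
  obtain ⟨idx, hidx⟩ := List.mem_iff_getElem?.1 hT
  have hil : idx < (arc (thinRing r e s) a len).length := (List.getElem?_eq_some_iff.1 hidx).1
  rw [length_arc (by rw [hG]; exact hlen)] at hil
  have hiG : idx < (thinRing r e s).length := by rw [hG]; omega
  rw [getElem?_arc hil hiG, hG] at hidx
  have hg : (idx + a) % (12 * (r / s) - 4) < 12 * (r / s) - 4 := Nat.mod_lt _ (by omega)
  rw [getElem?_thinRing hr hg] at hidx
  refine ⟨(idx + a) % (12 * (r / s) - 4), hg, ?_, (Option.some.inj hidx).symm⟩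
  unfold InArc
  rw [mod_add_sub_cancel ha (by omega : idx < 12 * (r / s) - 4)]
  exact hil

/-- **A ring tube at a position on the arc is a tube of the arc** (`g, a < 12n - 4`, `1 ≤ n = r / s`). [folklore] -/
theorem ringTube_mem_arc_of_inArc {r e s a len g : ℕ} (hr : 1 ≤ r / s) (ha : a < 12 * (r / s) - 4) (hg : g < 12 * (r / s) - 4)
    (hin : InArc (12 * (r / s) - 4) a len g) : ringTube r e s g ∈ arc (thinRing r e s) a len := by
  have hG := length_thinRing (e := e) hr
  unfold InArc at hin
  have hiG : (g + (12 * (r / s) - 4) - a) % (12 * (r / s) - 4) < (thinRing r e s).length := by rw [hG]; exact Nat.mod_lt _ (by omega)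
  have h := getElem_mem_arc (L := thinRing r e s) (a := a) hin hiG
  have hmod : ((g + (12 * (r / s) - 4) - a) % (12 * (r / s) - 4) + a) % (thinRing r e s).length = g := by
    rw [hG]; exact mod_sub_add_cancel ha hg
  simp only [hmod] at h
  obtain ⟨hg', hget⟩ := List.getElem?_eq_some_iff.1 (getElem?_thinRing (e := e) hr hg)
  rw [← hget]
  exact h

/-- **Reflected ring tubes**: `-v` lies in the box of the tube at the position `g` iff `v` lies in the
box of the tube half a ring further (`g < 12n - 4`, `1 ≤ n = r / s`). [folklore] -/
theorem neg_mem_ringTube_box_iff {r e s g : ℕ} (hr : 1 ≤ r / s) (hg : g < 12 * (r / s) - 4) {v : Site 2} :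
    -v ∈ (ringTube r e s g).box ↔ v ∈ (ringTube r e s ((g + (6 * (r / s) - 2)) % (12 * (r / s) - 4))).box := by
  unfold ringTube
  by_cases h : g < 6 * (r / s) - 2
  · have h1 : (g + (6 * (r / s) - 2)) % (12 * (r / s) - 4) = g + (6 * (r / s) - 2) := Nat.mod_eq_of_lt (by omega)
    rw [if_pos h, h1, if_neg (by omega), show g + (6 * (r / s) - 2) - (6 * (r / s) - 2) = g by omega, mem_box_neg]
  · have h1 : (g + (6 * (r / s) - 2)) % (12 * (r / s) - 4) = g - (6 * (r / s) - 2) := by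
      rw [Nat.mod_eq_sub_mod (by omega), Nat.mod_eq_of_lt (by omega)]; omega
    rw [if_neg h, h1, if_pos (by omega), mem_box_neg, neg_neg]

/-- `viewMap e` on ring boxes: a site of `viewMap e '' (ringTube g).box` lies in the box of the tube
at the absolute position `(g + shift) % G` (`shift = 0`, or half a ring for the reflected arms). [folklore] -/
theorem mem_ringTube_box_of_viewMap (e : Fin 4) {r es s : ℕ} (hr : 1 ≤ r / s) {g : ℕ} (hg : g < 12 * (r / s) - 4) {u : Site 2}
    (hu : u ∈ (ringTube r es s g).box) :
    viewMap e u ∈ (ringTube r es s ((g + (if 2 ≤ (e : ℕ) then 6 * (r / s) - 2 else 0)) % (12 * (r / s) - 4))).box := by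
  unfold viewMap
  by_cases h2 : 2 ≤ (e : ℕ)
  · rw [if_pos h2, if_pos h2]
    exact (neg_mem_ringTube_box_iff hr hg).1 (by rw [neg_neg]; exact hu)
  · rw [if_neg h2, if_neg h2, Nat.add_zero, Nat.mod_eq_of_lt hg]
    exact hu

/-! ### The generic separation of a ring tube from a lateral window -/

/-- **Monotone pieces**: on every side the positions of the pieces of lateral indices between
`ι₁` and `ι₂` lie between those of the two (`i < 6`, `ι₁ ≤ κ ≤ ι₂ < n`). [folklore] -/
theorem piecePos_mem_of_mem {n i ι₁ ι₂ κ : ℕ} (h1 : ι₁ ≤ κ) (h2 : κ ≤ ι₂) (hn : ι₂ < n) :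
    min (piecePos n i ι₁) (piecePos n i ι₂) ≤ piecePos n i κ ∧ piecePos n i κ ≤ max (piecePos n i ι₁) (piecePos n i ι₂) := by
  unfold piecePos
  split_ifs <;> simp only [min_def, max_def] <;> split_ifs <;> omega

/-- **A ring tube off the window of a lateral range avoids every set confined to that range.** On the
ring of radius `r = n s` (`1 ≤ n`, `2e ≤ r`, `d + e < s`): let `S` be a set of sites in the `i`-th
sector with margin `λ > 2e` whose lateral coordinates lie in `[A - d, B + d]`, `-r ≤ A ≤ B`;
let `ιA, ιB` be the lateral indices of `A, B`, `1 ≤ ιA`, `ιB + 2 ≤ n`. Then a ring tube whose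
position `g` is outside the positions `[min P₋ P₊, max P₋ P₊ + 1]` of the pieces of indices
`ιA - 1` and `ιB + 1` of the side `i` does not meet `S`: on another side by sectors, on the side `i`
because its lateral index would have to lie in `[ιA - 1, ιB + 1]`. [folklore] -/
theorem ringTube_disjoint_of_lat {r e s n : ℕ} (hn : n = r / s) (hr : 1 ≤ n) (hsr : s ∣ r) (he : 2 * e ≤ r) {d : ℕ} (hde : d + e < s)
    {g : ℕ} (hg : g < 12 * n - 4) {i : ℕ} (hi : i < 6) {A B : ℤ} (hA : -(r : ℤ) ≤ A) (hAB : A ≤ B)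
    (hιA : 1 ≤ latIdx s r A) (hιB : latIdx s r B + 2 ≤ n)
    (hout : g < min (piecePos n i (latIdx s r A - 1)) (piecePos n i (latIdx s r B + 1)) ∨
      max (piecePos n i (latIdx s r A - 1)) (piecePos n i (latIdx s r B + 1)) + 1 < g)
    {S : Set (Site 2)} {lam : ℤ} (hlam : 2 * (e : ℤ) < lam) (hS : S ⊆ sectorNear i lam)
    (hSlat : ∀ v ∈ S, A - d ≤ lat i v ∧ lat i v ≤ B + d) :
    Disjoint (ringTube r e s g).box S := by
  subst hn
  rw [Set.disjoint_left]
  intro v hv hvS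
  obtain ⟨hsec, hl1, hl2, -, -⟩ := ringTube_bounds hr hsr he hg hv
  by_cases hside : ringSide r s g = i
  · rw [hside] at hl1 hl2 hsec
    obtain ⟨hvl1, hvl2⟩ := hSlat v hvS
    have hs1 : 1 ≤ s := by
      by_contra h0; push Not at h0
      have : s = 0 := by omega
      rw [this, Nat.div_zero] at hr; omega
    have hspecA := latIdx_spec (s := s) (r := r) hs1 hA
    have hspecB := latIdx_spec (s := s) (r := r) hs1 (by omega : -(r : ℤ) ≤ B)
    have hde' : (d : ℤ) + e < s := by exact_mod_cast hde
    -- the lateral index of the tube is within one of `[ιA, ιB]`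
    have hκ1 : latIdx s r A ≤ ringLat r s g + 1 :=
      idx_le_succ_of_le_add (d := (d : ℤ) + e) (ι := latIdx s r A) (κ := ringLat r s g) (r := (r : ℤ)) (ξ := A) hde' hspecA.1
        (by linarith)
    have hκ2 : ringLat r s g ≤ latIdx s r B + 1 :=
      idx_le_succ_of_lt (d := (d : ℤ) + e) hde' (by linarith) hspecB.2
    have hpos := pos_le_of_side_lat hr hg
    rw [hside] at hpos
    have hmem := piecePos_mem_of_mem (n := r / s) (i := i) (show latIdx s r A - 1 ≤ ringLat r s g by omega) hκ2 (by omega)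
    rcases hout with hout | hout <;> omega
  · exact Set.disjoint_left.1 (disjoint_sectorNear (ringSide_lt r s g) hi hside (by omega)) hsec (hS hvS)

/-! ### Slots in range, admissible -/

namespace Slot4

variable (P : OParams) (σ : Slot4)

/-- **The slot's indices are in range**: frames `< 6`, scale indices `< K`, target choices `< 5`,
levels `< 8`. [folklore] -/
structure InRange : Prop where
  /-- frames -/
  hfr : ∀ e, σ.fr e < 6
  /-- scale indices -/
  hsc : ∀ e, σ.sc e < P.K
  /-- target choices -/
  htc : ∀ e, σ.tc e < 5
  /-- levels -/
  hlv : ∀ e, σ.lv e < 8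

/-- **Admissible slot**: every window can hold a middle tip row `t` with `-2M + R₀ ≤ t ≤ -R₀`. [folklore] -/
def Adm (P' : OParams) (σ' : Slot4) : Prop := ∀ e, σ'.T P' e ≤ -(P'.R₀ : ℤ) ∧ -(2 * (P'.M : ℤ)) + P'.R₀ < σ'.T P' e + P'.w

variable {P σ}

/-- A slot holding the arm `e` has an admissible window for `e`. [folklore] -/
theorem adm_of_mem {e : Fin 4} {ω : SiteConfig (Site 2)} (hω : ω ∈ σ.armE P e) :
    σ.T P e ≤ -(P.R₀ : ℤ) ∧ -(2 * (P.M : ℤ)) + P.R₀ < σ.T P e + P.w := by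
  obtain ⟨F, hmid, -, h1, h2⟩ := hω
  exact ⟨by omega, by omega⟩

/-- The reflected frame is a frame. [folklore] -/
theorem fr'_lt (hσ : σ.InRange P) (e : Fin 4) : σ.fr' e < 6 := by
  unfold fr'; split_ifs
  · exact Nat.mod_lt _ (by norm_num)
  · exact hσ.hfr e

/-- The absolute landing side is a frame index. [folklore] -/
theorem ts_lt (e : Fin 4) : ts e < 6 := by
  unfold ts bs; split_ifs <;> norm_num

/-- Distinct arms land on distinct sides. [folklore] -/
theorem ts_ne_of_ne {e b : Fin 4} (h : e ≠ b) : ts e ≠ ts b := by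
  have he := e.isLt; have hb := b.isLt
  unfold ts bs
  intro heq
  apply h
  apply Fin.ext
  split_ifs at heq <;> omega

/-- **The numeric facts of the arm `e` of a valid rung and a slot in range** (scale, ring, spoke,
approach, target). [folklore] -/
theorem arm_facts (hV : P.Valid) (hσ : σ.InRange P) (e : Fin 4) :
    (P.k₀ : ℤ) ≤ σ.k P e ∧ 32 * (σ.k P e : ℤ) ≤ P.μ ∧
      2 * (P.M : ℤ) + (2 * σ.lv e + 1) * P.μ < σ.r P e ∧ (σ.r P e : ℤ) ≤ 2 * P.M + (2 * σ.lv e + 1) * P.μ + P.s ∧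
      ((σ.nr P e : ℕ) : ℤ) * P.s = σ.r P e ∧ (σ.r P e : ℤ) - 2 * P.e + σ.W P e = P.N' + (P.N' / 16 : ℕ) ∧
      (σ.r P e : ℤ) + 2 * P.e ≤ 4 * P.M ∧ (σ.L P e : ℤ) = (2 * σ.lv e + 1) * P.μ + 2 * P.s + 4 * P.e ∧
      1 ≤ σ.nr P e ∧ σ.nr P e = σ.r P e / P.s ∧ σ.G P e = 12 * σ.nr P e - 4 ∧ P.s ∣ σ.r P e ∧
      (-(2 * (P.M : ℤ)) + (4 * P.M / 16 : ℕ) ≤ σ.t P e ∧ σ.t P e ≤ -(P.M : ℤ) - (4 * P.M / 16 : ℕ)) ∧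
      ((P.μ : ℤ) ≤ (2 * σ.lv e + 1) * P.μ ∧ (2 * (σ.lv e : ℤ) + 1) * P.μ ≤ 15 * P.μ) := by
  have hk1 : (P.k₀ : ℤ) ≤ σ.k P e := by exact_mod_cast le_trapScale P.k₀ (σ.sc e)
  have hk2 : 32 * (σ.k P e : ℤ) ≤ P.μ := by exact_mod_cast P.scale_le (hσ.hsc e)
  obtain ⟨r1, r2, r3, r4, r5, r6⟩ := hV.ring_ifacts (hσ.hlv e)
  obtain ⟨-, -, n3, n4, -, -, n7, -⟩ := hV.ring_facts (hσ.hlv e)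
  have hdiv : P.s ∣ σ.r P e := ⟨P.nL (σ.lv e), by rw [mul_comm]; exact n3.symm⟩
  have hμ0 : (0 : ℤ) ≤ P.μ := by positivity
  have hlv : (σ.lv e : ℤ) ≤ 7 := by have := hσ.hlv e; omega
  have hlv0 : (0 : ℤ) ≤ σ.lv e := by positivity
  exact ⟨hk1, hk2, r1, r2, r3, r4, r5, r6, n4, rfl, n7, hdiv, hV.tgtRow4_mem (hσ.htc e), by nlinarith, by nlinarith⟩

end Slot4

/-! ### Where the pieces of a private support are -/

namespace Slot4

variable {P : OParams} {σ : Slot4}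

/-- **The pieces of a private support.** A site of `privE e` lies in the near set of the tip of `e`
(slot frame box and spoke, absolute frame `fr e`), or in the box of a ring tube of the ring of `e` at an
absolute position whose reading position is on the arc, or in the approach box, or in the target box
(both `frameIso (ts e)` of the standard boxes). [folklore] -/
theorem mem_privE_cases (hV : P.Valid) (hσ : σ.InRange P) (hR : RouteOK P σ) {e : Fin 4} {v : Site 2} (hv : v ∈ (↑(σ.privE P e) : Set (Site 2))) :
    v ∈ onearSet (σ.fr e) P.M (σ.k P e) (σ.T P e) P.w (σ.L P e) P.ε ∨
      (∃ g, g < σ.G P e ∧ InArc (σ.G P e) (σ.ast e) (σ.aln e) (σ.toView P e g) ∧ v ∈ (ringTube (σ.r P e) P.e P.s g).box) ∨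
      v ∈ frameIso (ts e) '' triStrip ((σ.r P e : ℤ) - 2 * P.e) (σ.t P e) (σ.W P e) (P.N' / 64) ∨
      v ∈ frameIso (ts e) '' triStrip ((P.N' : ℤ) + 1) (σ.t P e - (P.N' / 64 : ℕ)) (P.N' / 16 - 1) (2 * (P.N' / 64)) := by
  obtain ⟨-, -, -, -, -, -, -, -, hn1, hns, hG, -, -, -⟩ := arm_facts hV hσ e
  obtain ⟨hast, -, haln⟩ := hR.1 e
  have hfr := hσ.hfr e
  unfold privE at hv
  rw [Finset.coe_image, coe_ocorrFin4] at hv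
  obtain ⟨u, hu, rfl⟩ := hv
  have hview_fr : ∀ x : Site 2, viewMap e (frameIso (σ.fr' e) x) = frameIso (σ.fr e) x := fun x => by
    unfold viewMap Slot4.fr'
    by_cases h2 : 2 ≤ (e : ℕ)
    · rw [if_pos h2, if_pos h2, frameIso_add_three hfr, neg_neg]
    · rw [if_neg h2, if_neg h2]
  have hview_bs : ∀ x : Site 2, viewMap e (frameIso (bs e) x) = frameIso (ts e) x := fun x => by
    unfold viewMap Slot4.ts
    have hbs : bs e < 6 := by unfold bs; split_ifs <;> norm_num
    by_cases h2 : 2 ≤ (e : ℕ)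
    · rw [if_pos h2, if_pos h2, ← frameIso_add_three hbs]
      unfold bs; split_ifs <;> rfl
    · rw [if_neg h2, if_neg h2]
  rcases hu with ((⟨x, hx, rfl⟩ | hu) | ⟨x, hx, rfl⟩)
  · left; rw [hview_fr]; exact ⟨x, hx, rfl⟩
  · right; left
    obtain ⟨T, hT, huT⟩ := hu
    have hGdef : σ.G P e = 12 * (σ.r P e / P.s) - 4 := by rw [hG, hns]
    have hshdef : σ.shift P e = if 2 ≤ (e : ℕ) then 6 * (σ.r P e / P.s) - 2 else 0 := by unfold Slot4.shift; rw [hns]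
    rw [hns] at hn1
    rw [hGdef] at hast haln
    obtain ⟨g, hg, hin, rfl⟩ := exists_pos_of_mem_arc hn1 hast haln hT
    have hg' : g < σ.G P e := by rw [hGdef]; exact hg
    have hGpos : 0 < σ.G P e := by omega
    have hshift : σ.shift P e < σ.G P e := by rw [hshdef, hGdef]; split_ifs <;> omega
    refine ⟨(g + σ.shift P e) % σ.G P e, Nat.mod_lt _ hGpos, ?_, ?_⟩
    · have hview : σ.toView P e ((g + σ.shift P e) % σ.G P e) = g := by
        unfold Slot4.toView; exact mod_add_sub_cancel hshift hg'
      rw [hview, hGdef]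
      exact hin
    · rw [hGdef, hshdef]
      exact mem_ringTube_box_of_viewMap e hn1 hg huT
  · rcases hx with hx | hx
    · right; right; left; rw [hview_bs]; exact ⟨x, hx, rfl⟩
    · right; right; right; rw [hview_bs]; exact ⟨x, hx, rfl⟩

/-- **Where the approach box is**: in the sector of its side with margin `M/8`, lateral coordinate in
`[t, t + N'/64]`, depth `≥ r - 2e` (hence norm `≥ r - 2e`) (valid rung, slot in range). [folklore] -/
theorem approach_bounds (hV : P.Valid) (hσ : σ.InRange P) {e : Fin 4} {v : Site 2}
    (hv : v ∈ frameIso (ts e) '' triStrip ((σ.r P e : ℤ) - 2 * P.e) (σ.t P e) (σ.W P e) (P.N' / 64)) :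
    v ∈ sectorNear (ts e) ((P.M : ℤ) / 8) ∧ σ.t P e ≤ lat (ts e) v ∧ lat (ts e) v ≤ σ.t P e + (P.N' / 64 : ℕ) ∧
      (σ.r P e : ℤ) - 2 * P.e ≤ triNorm v := by
  obtain ⟨hs, hk₀, hμ, hw1, hw2, he1, he2, hε1, hε2, -, -, -, -, -, -, hN, -, -, hn, hμM, hR₀, hR₀M, -⟩ := hV.ifacts
  obtain ⟨-, -, r1, r2, -, r4, r5, -, -, -, -, -, ⟨ht1, ht2⟩, hμo, -⟩ := arm_facts hV hσ e
  obtain ⟨x, hx, rfl⟩ := hv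
  rw [mem_triStrip] at hx
  have hts := ts_lt e
  have hN64 : ((P.N' / 64 : ℕ) : ℤ) ≤ P.M / 16 + 1 := by rw [show P.N' = 4 * P.M from by exact_mod_cast hV.facts.2.2.2.2.2.2.2.2.2.2.2.2.1]; omega
  refine ⟨(frameIso_mem_sectorNear_iff hts).2 ⟨by omega, by omega⟩, by rw [lat_frameIso hts]; exact hx.2.2.1,
    by rw [lat_frameIso hts]; exact hx.2.2.2, ?_⟩
  calc (σ.r P e : ℤ) - 2 * P.e ≤ x 0 := hx.1
    _ = dep (ts e) (frameIso (ts e) x) := (dep_frameIso hts x).symm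
    _ ≤ _ := dep_le_triNorm hts _

/-- **Where the target box is**: in the sector of its side with margin `M/8`, lateral coordinate in
`[t - N'/64, t + N'/64]`, norm `> 4M`. [folklore] -/
theorem target_bounds (hV : P.Valid) (hσ : σ.InRange P) {e : Fin 4} {v : Site 2}
    (hv : v ∈ frameIso (ts e) '' triStrip ((P.N' : ℤ) + 1) (σ.t P e - (P.N' / 64 : ℕ)) (P.N' / 16 - 1) (2 * (P.N' / 64))) :
    v ∈ sectorNear (ts e) ((P.M : ℤ) / 8) ∧ σ.t P e - (P.N' / 64 : ℕ) ≤ lat (ts e) v ∧ lat (ts e) v ≤ σ.t P e + (P.N' / 64 : ℕ) ∧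
      4 * (P.M : ℤ) < triNorm v := by
  obtain ⟨hs, hk₀, hμ, hw1, hw2, he1, he2, hε1, hε2, -, -, -, -, -, -, hN, -, -, hn, hμM, hR₀, hR₀M, -⟩ := hV.ifacts
  obtain ⟨-, -, -, -, -, -, -, -, -, -, -, -, ⟨ht1, ht2⟩, -⟩ := arm_facts hV hσ e
  obtain ⟨x, hx, rfl⟩ := hv
  rw [mem_triStrip] at hx
  have hts := ts_lt e
  have hN4 : (P.N' : ℤ) = 4 * P.M := by exact_mod_cast hV.facts.2.2.2.2.2.2.2.2.2.2.2.2.1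
  have hN64 : ((P.N' / 64 : ℕ) : ℤ) ≤ P.M / 16 + 1 := by rw [show P.N' = 4 * P.M from by exact_mod_cast hV.facts.2.2.2.2.2.2.2.2.2.2.2.2.1]; omega
  refine ⟨(frameIso_mem_sectorNear_iff hts).2 ⟨by push_cast at hx; omega, by omega⟩, by rw [lat_frameIso hts]; exact hx.2.2.1,
    by rw [lat_frameIso hts]; push_cast at hx; omega, ?_⟩
  calc 4 * (P.M : ℤ) < x 0 := by omega
    _ = dep (ts e) (frameIso (ts e) x) := (dep_frameIso hts x).symm
    _ ≤ _ := dep_le_triNorm hts _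

end Slot4

/-! ### Lateral indices of in-range rows -/

/-- A row at least `m` chunks above the bottom of the side has lateral index `≥ m` (`1 ≤ s`). [folklore] -/
theorem le_latIdx_of_le {s r m : ℕ} (hs : 1 ≤ s) {ξ : ℤ} (h : -(r : ℤ) + m * s ≤ ξ) : m ≤ latIdx s r ξ := by
  have hξ : -(r : ℤ) ≤ ξ := le_trans (by nlinarith [(show (0 : ℤ) ≤ m * s from by positivity)]) h
  have hspec := latIdx_spec (s := s) (r := r) hs hξ
  by_contra h'
  push Not at h'
  have : (latIdx s r ξ : ℤ) + 1 ≤ m := by exact_mod_cast h'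
  have hs0 : (0 : ℤ) < s := by exact_mod_cast hs
  nlinarith [hspec.2]

/-- A row at least `m` chunks below the top of the side has lateral index `< n - m` (`n s = r`, `1 ≤ s`). [folklore] -/
theorem latIdx_add_lt {s r n m : ℕ} (hs : 1 ≤ s) (hns : (n : ℤ) * s = r) {ξ : ℤ} (hξ : -(r : ℤ) ≤ ξ) (h : ξ + m * s < 0) :
    latIdx s r ξ + m < n := by
  have hspec := latIdx_spec (s := s) (r := r) hs hξ
  by_contra h'
  push Not at h'
  have : (n : ℤ) ≤ latIdx s r ξ + m := by exact_mod_cast h'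
  have hs0 : (0 : ℤ) < s := by exact_mod_cast hs
  nlinarith [hspec.1]

namespace Slot4

variable {P : OParams} {σ : Slot4}

/-! ### The pieces, pairwise -/

/-- **Near sets of arms of different colours are disjoint** (window gap on a common frame from the
routing predicate, sectors otherwise). [folklore] -/
theorem near_near_false (hV : P.Valid) (hσ : σ.InRange P) (hadm : σ.Adm P) (hR : RouteOK P σ) {e b : Fin 4} (hcol : col e ≠ col b)
    {v : Site 2} (hve : v ∈ onearSet (σ.fr e) P.M (σ.k P e) (σ.T P e) P.w (σ.L P e) P.ε)
    (hvb : v ∈ onearSet (σ.fr b) P.M (σ.k P b) (σ.T P b) P.w (σ.L P b) P.ε) : False := by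
  obtain ⟨hs, hk₀, hμ, hw1, hw2, he1, he2, hε1, hε2, -, -, -, -, -, -, hN, -, -, hn, hμM, hR₀, hR₀M, -⟩ := hV.ifacts
  obtain ⟨ke1, ke2, -, -, -, -, -, Le, -, -, -, -, -, hμe, -⟩ := arm_facts hV hσ e
  obtain ⟨kb1, kb2, -, -, -, -, -, Lb, -, -, -, -, -, hμb, -⟩ := arm_facts hV hσ b
  have hsep : σ.fr e ≠ σ.fr b ∨ σ.T P e + 8 * σ.k P e < σ.T P b + P.w ∨ σ.T P b + 8 * σ.k P b < σ.T P e + P.w := by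
    by_cases h : σ.fr e = σ.fr b
    · exact Or.inr (hR.2.2.2.2.2.2.2 e b hcol h)
    · exact Or.inl h
  have hμ0 : (0 : ℤ) ≤ (2 * (σ.lv e : ℤ) + 1) * P.μ := by positivity
  have hμ0' : (0 : ℤ) ≤ (2 * (σ.lv b : ℤ) + 1) * P.μ := by positivity
  exact onearSet_disjoint_onearSet (hσ.hfr e) (hσ.hfr b) (by omega) (by omega) (by omega) (by omega)
    (by zify; rw [Le]; omega) (by zify; rw [Lb]; omega) ⟨(hadm e).1, (hadm e).2, (hadm b).1, (hadm b).2⟩ (by omega) ⟨by omega, by omega⟩ hsep hve hvb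

/-- **The slot box of a near set meets no ring** (its norm is at most `2M + 5k`). [folklore] -/
theorem slotBox_norm_le (hV : P.Valid) (hσ : σ.InRange P) (hadm : σ.Adm P) {e : Fin 4} {u : Site 2}
    (hu : u ∈ (↑(oslotFrame P.M (σ.k P e) (σ.T P e) P.w) : Set (Site 2))) : triNorm (frameIso (σ.fr e) u) ≤ 2 * (P.M : ℤ) + 5 * σ.k P e := by
  obtain ⟨hs, hk₀, hμ, hw1, hw2, he1, he2, hε1, hε2, -, -, -, -, -, -, hN, -, -, hn, hμM, hR₀, hR₀M, -⟩ := hV.ifacts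
  obtain ⟨ke1, ke2, -⟩ := arm_facts hV hσ e
  obtain ⟨ha1, ha2⟩ := hadm e
  rw [Finset.mem_coe, mem_oslotFrame (by omega)] at hu
  rw [triNorm_frameIso (σ.fr e) (hσ.hfr e)]
  exact triNorm_le_iff_lin.2 (by omega)

/-- **A near set and a ring of another colour**: the slot box is below every ring; the spoke is below
the ring of `b` if `b` is on a higher level, and passes it through the spoke window, off the arc of
`b`, otherwise (routing predicate). [folklore] -/
theorem near_arc_false (hV : P.Valid) (hσ : σ.InRange P) (hadm : σ.Adm P) (hR : RouteOK P σ) {e b : Fin 4} (hcol : col e ≠ col b)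
    (heb : e ≠ b) {v : Site 2} (hve : v ∈ onearSet (σ.fr e) P.M (σ.k P e) (σ.T P e) P.w (σ.L P e) P.ε)
    {g : ℕ} (hg : g < σ.G P b) (hin : InArc (σ.G P b) (σ.ast b) (σ.aln b) (σ.toView P b g))
    (hvb : v ∈ (ringTube (σ.r P b) P.e P.s g).box) : False := by
  obtain ⟨hs, hk₀, hμ, hw1, hw2, he1, he2, hε1, hε2, -, -, -, -, -, -, hN, -, -, hn, hμM, hR₀, hR₀M, -⟩ := hV.ifacts
  obtain ⟨ke1, ke2, re1, re2, -, -, -, Le, -, -, -, -, -, hμe, hμe'⟩ := arm_facts hV hσ e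
  obtain ⟨kb1, kb2, rb1, rb2, nsb, -, -, -, nb1, nsb', Gb, dvb, -, hμb, -⟩ := arm_facts hV hσ b
  obtain ⟨ha1, ha2⟩ := hadm e
  rw [nsb'] at nb1
  have hgb : g < 12 * (σ.r P b / P.s) - 4 := by rw [Gb, nsb'] at hg; exact hg
  have heb' : 2 * P.e ≤ σ.r P b := by zify; omega
  obtain ⟨-, -, -, hnorm1, -⟩ := ringTube_bounds nb1 dvb heb' hgb hvb
  obtain ⟨u, hu, rfl⟩ := hve
  rcases hu with hu | hu
  · -- the slot box is below every ring
    have h := slotBox_norm_le hV hσ hadm hu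
    omega
  -- the spoke
  obtain ⟨h1, h2, h3, h4⟩ := bounds_of_mem_ospokeBox hu
  have hlv : σ.lv e ≠ σ.lv b := hR.2.1 e b heb
  rcases lt_or_gt_of_ne hlv with hlt | hlt
  · -- `b` on a higher level: the spoke of `e` ends below the ring of `b`
    have hle : (σ.lv e : ℤ) + 1 ≤ σ.lv b := by exact_mod_cast hlt
    have hμ0 : (0 : ℤ) ≤ P.μ := by positivity
    have hkey : (2 * (σ.lv e : ℤ) + 1) * P.μ + 2 * P.μ ≤ (2 * (σ.lv b : ℤ) + 1) * P.μ := by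
      rw [show (2 * (σ.lv e : ℤ) + 1) * P.μ + 2 * P.μ = (2 * (σ.lv e : ℤ) + 3) * P.μ by ring]
      exact mul_le_mul_of_nonneg_right (by linarith) hμ0
    have key : 2 * (P.M : ℤ) + 2 * σ.k P e - 1 + σ.L P e < σ.r P b - P.s - 2 * P.e := by rw [Le]; omega
    have hk4 : 4 * ((σ.k P e / 4 : ℕ) : ℤ) ≤ σ.k P e := by omega
    have hn2 := (triNorm_le_iff_lin (x := u) (ρ := 2 * (P.M : ℤ) + 2 * σ.k P e - 1 + σ.L P e)).2 (by omega)
    rw [← triNorm_frameIso (σ.fr e) (hσ.hfr e)] at hn2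
    omega
  · -- `b` on a lower level: the spoke crosses the ring of `b` through its window, off the arc
    have hwin := hR.2.2.2.2.1 b e hcol.symm hlt
    set ι := latIdx P.s (σ.r P b) (σ.ξ P e) with hι
    have hξr : -(σ.r P b : ℤ) ≤ σ.ξ P e := by unfold Slot4.ξ; omega
    have hι1 : 1 ≤ ι := le_latIdx_of_le (m := 1) (by omega) (by unfold Slot4.ξ; push_cast; omega)
    have hι2 : ι + 2 < σ.nr P b := latIdx_add_lt (m := 2) (by omega) nsb hξr (by unfold Slot4.ξ; push_cast; omega)
    rw [nsb'] at hι2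
    have hout : g < min (piecePos (σ.r P b / P.s) (σ.fr e) (ι - 1)) (piecePos (σ.r P b / P.s) (σ.fr e) (ι + 1)) ∨
        max (piecePos (σ.r P b / P.s) (σ.fr e) (ι - 1)) (piecePos (σ.r P b / P.s) (σ.fr e) (ι + 1)) + 1 < g := by
      by_contra hc
      push Not at hc
      -- then `g` is one of the six window positions
      have hlo : σ.spokeWinLo P e b = min (piecePos (σ.r P b / P.s) (σ.fr e) (ι - 1)) (piecePos (σ.r P b / P.s) (σ.fr e) (ι + 1)) ∧
          max (piecePos (σ.r P b / P.s) (σ.fr e) (ι - 1)) (piecePos (σ.r P b / P.s) (σ.fr e) (ι + 1)) + 1 = σ.spokeWinLo P e b + 5 := by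
        unfold Slot4.spokeWinLo piecePos
        rw [← nsb', ← hι]
        rw [← nsb'] at hι2
        constructor <;> split_ifs <;> simp only [min_def, max_def] <;> split_ifs <;> omega
      obtain ⟨q, hq, hgq⟩ : ∃ q, q < 6 ∧ g = σ.spokeWinLo P e b + q := ⟨g - σ.spokeWinLo P e b, by omega, by omega⟩
      rw [hgq] at hin
      exact hwin q hq hin
    have hlam : 2 * (P.e : ℤ) < (P.R₀ : ℤ) - 2 * σ.k P e - P.w - P.ε - 2 * P.e := by omega
    refine Set.disjoint_left.1 (ringTube_disjoint_of_lat rfl nb1 dvb heb' (d := P.ε) (by omega) hgb (hσ.hfr e) hξr le_rfl hι1 (by omega) hout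
      (S := frameIso (σ.fr e) '' (ospokeTube P.M (σ.k P e) (σ.T P e) P.w (σ.L P e) P.ε).box) (lam := (P.R₀ : ℤ) - 2 * σ.k P e - P.w - P.ε - 2 * P.e)
      (by omega) ?_ ?_) hvb ⟨u, hu, rfl⟩
    · rintro x ⟨y, hy, rfl⟩
      obtain ⟨g1, g2, g3, g4⟩ := bounds_of_mem_ospokeBox hy
      refine (frameIso_mem_sectorNear_iff (hσ.hfr e)).2 ⟨?_, ?_⟩
      · unfold Slot4.ξ at hι hξr; omega
      · have hk4 : 4 * ((σ.k P e / 4 : ℕ) : ℤ) ≤ σ.k P e := by omega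
        omega
    · rintro x ⟨y, hy, rfl⟩
      obtain ⟨g1, g2, g3, g4⟩ := bounds_of_mem_ospokeBox hy
      rw [lat_frameIso (hσ.hfr e)]
      unfold Slot4.ξ; constructor <;> omega

/-- **A near set and the approach box of another colour**: sectors on different sides, the
danger-zone condition of the routing predicate on a common side. [folklore] -/
theorem near_appr_false (hV : P.Valid) (hσ : σ.InRange P) (hadm : σ.Adm P) (hR : RouteOK P σ) {e b : Fin 4} (hcol : col e ≠ col b)
    {v : Site 2} (hve : v ∈ onearSet (σ.fr e) P.M (σ.k P e) (σ.T P e) P.w (σ.L P e) P.ε)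
    (hvb : v ∈ frameIso (ts b) '' triStrip ((σ.r P b : ℤ) - 2 * P.e) (σ.t P b) (σ.W P b) (P.N' / 64)) : False := by
  obtain ⟨hs, hk₀, hμ, hw1, hw2, he1, he2, hε1, hε2, -, -, -, -, -, -, hN, -, -, hn, hμM, hR₀, hR₀M, -⟩ := hV.ifacts
  obtain ⟨ke1, ke2, -, -, -, -, -, Le, -, -, -, -, -, hμe, -⟩ := arm_facts hV hσ e
  obtain ⟨ha1, ha2⟩ := hadm e
  obtain ⟨hsec, hl1, hl2, -⟩ := approach_bounds hV hσ hvb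
  obtain ⟨u, rfl, hu0, hu0', hu1, hu1'⟩ := exists_of_mem_onearSet (by omega) (by omega) (by zify; rw [Le]; omega) hve
  by_cases hside : σ.fr e = ts b
  · -- rows
    have hfar := hR.2.2.2.2.2.2.1 e b hcol hside
    rw [← hside, lat_frameIso (hσ.hfr e)] at hl1 hl2
    unfold Slot4.ξ at hfar
    rcases hfar with hfar | hfar <;> omega
  · have hse : frameIso (σ.fr e) u ∈ sectorNear (σ.fr e) ((P.R₀ : ℤ) - (4 * σ.k P e + P.w)) :=
      (frameIso_mem_sectorNear_iff (hσ.hfr e)).2 ⟨by omega, by omega⟩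
    exact Set.disjoint_left.1 (disjoint_sectorNear (hσ.hfr e) (ts_lt b) hside (by omega)) hse hsec

/-- **A near set lies below every target box** (norm `≤ 2M + 2k + L < 4M`). [folklore] -/
theorem near_tgt_false (hV : P.Valid) (hσ : σ.InRange P) (hadm : σ.Adm P) {e b : Fin 4}
    {v : Site 2} (hve : v ∈ onearSet (σ.fr e) P.M (σ.k P e) (σ.T P e) P.w (σ.L P e) P.ε)
    (hvb : v ∈ frameIso (ts b) '' triStrip ((P.N' : ℤ) + 1) (σ.t P b - (P.N' / 64 : ℕ)) (P.N' / 16 - 1) (2 * (P.N' / 64))) : False := by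
  obtain ⟨hs, hk₀, hμ, hw1, hw2, he1, he2, hε1, hε2, -, -, -, -, -, -, hN, -, -, hn, hμM, hR₀, hR₀M, -⟩ := hV.ifacts
  obtain ⟨ke1, ke2, -, -, -, -, -, Le, -, -, -, -, -, hμe, hμe'⟩ := arm_facts hV hσ e
  obtain ⟨ha1, ha2⟩ := hadm e
  obtain ⟨-, -, -, hnorm⟩ := target_bounds hV hσ hvb
  have h := norm_of_mem_onearSet (hσ.hfr e) (k := σ.k P e) (ε := P.ε) (L := σ.L P e) (T₀ := σ.T P e) (w := P.w) (M := P.M)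
    (by omega) (by omega) (by zify; rw [Le]; omega) (by omega) (by omega) hve
  have : 2 * (P.M : ℤ) + 2 * σ.k P e + σ.L P e ≤ 4 * P.M := by rw [Le]; omega
  omega

/-- **Rings of distinct levels lie in disjoint norm bands.** [folklore] -/
theorem arc_arc_false (hV : P.Valid) (hσ : σ.InRange P) (hR : RouteOK P σ) {e b : Fin 4} (heb : e ≠ b)
    {g : ℕ} (hg : g < σ.G P e) {v : Site 2} (hve : v ∈ (ringTube (σ.r P e) P.e P.s g).box)
    {g' : ℕ} (hg' : g' < σ.G P b) (hvb : v ∈ (ringTube (σ.r P b) P.e P.s g').box) : False := by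
  obtain ⟨hs, hk₀, hμ, hw1, hw2, he1, he2, hε1, hε2, -, -, -, -, -, -, hN, -, -, hn, hμM, hR₀, hR₀M, -⟩ := hV.ifacts
  obtain ⟨-, -, re1, re2, -, -, -, -, ne1, nse, Ge, dve, -, hμe, -⟩ := arm_facts hV hσ e
  obtain ⟨-, -, rb1, rb2, -, -, -, -, nb1, nsb, Gb, dvb, -, hμb, -⟩ := arm_facts hV hσ b
  rw [nse] at ne1; rw [nsb] at nb1
  have hge : g < 12 * (σ.r P e / P.s) - 4 := by rw [Ge, nse] at hg; exact hg
  have hgb : g' < 12 * (σ.r P b / P.s) - 4 := by rw [Gb, nsb] at hg'; exact hg'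
  obtain ⟨-, -, -, e1, e2⟩ := ringTube_bounds ne1 dve (by zify; omega) hge hve
  obtain ⟨-, -, -, b1, b2⟩ := ringTube_bounds nb1 dvb (by zify; omega) hgb hvb
  have hlv : σ.lv e ≠ σ.lv b := hR.2.1 e b heb
  have hμ0 : (0 : ℤ) ≤ P.μ := by positivity
  rcases lt_or_gt_of_ne hlv with hlt | hlt
  · have hle : (σ.lv e : ℤ) + 1 ≤ σ.lv b := by exact_mod_cast hlt
    have hkey : (2 * (σ.lv e : ℤ) + 1) * P.μ + 2 * P.μ ≤ (2 * (σ.lv b : ℤ) + 1) * P.μ := by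
      rw [show (2 * (σ.lv e : ℤ) + 1) * P.μ + 2 * P.μ = (2 * (σ.lv e : ℤ) + 3) * P.μ by ring]
      exact mul_le_mul_of_nonneg_right (by linarith) hμ0
    omega
  · have hle : (σ.lv b : ℤ) + 1 ≤ σ.lv e := by exact_mod_cast hlt
    have hkey : (2 * (σ.lv b : ℤ) + 1) * P.μ + 2 * P.μ ≤ (2 * (σ.lv e : ℤ) + 1) * P.μ := by
      rw [show (2 * (σ.lv b : ℤ) + 1) * P.μ + 2 * P.μ = (2 * (σ.lv b : ℤ) + 3) * P.μ by ring]
      exact mul_le_mul_of_nonneg_right (by linarith) hμ0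
    omega

/-- **A ring and the approach box of another colour**: below the box if the box leaves a higher ring;
otherwise the box crosses the ring through the approach window, off the arc (routing predicate). [folklore] -/
theorem arc_appr_false (hV : P.Valid) (hσ : σ.InRange P) (hR : RouteOK P σ) {e b : Fin 4} (hcol : col e ≠ col b) (heb : e ≠ b)
    {g : ℕ} (hg : g < σ.G P e) (hin : InArc (σ.G P e) (σ.ast e) (σ.aln e) (σ.toView P e g))
    {v : Site 2} (hve : v ∈ (ringTube (σ.r P e) P.e P.s g).box)
    (hvb : v ∈ frameIso (ts b) '' triStrip ((σ.r P b : ℤ) - 2 * P.e) (σ.t P b) (σ.W P b) (P.N' / 64)) : False := by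
  obtain ⟨hs, hk₀, hμ, hw1, hw2, he1, he2, hε1, hε2, -, -, -, -, -, -, hN, -, -, hn, hμM, hR₀, hR₀M, -⟩ := hV.ifacts
  obtain ⟨-, -, re1, re2, nse', -, -, -, ne1, nse, Ge, dve, -, hμe, -⟩ := arm_facts hV hσ e
  obtain ⟨-, -, rb1, rb2, -, -, -, -, -, -, -, -, ⟨tb1, tb2⟩, hμb, -⟩ := arm_facts hV hσ b
  rw [nse] at ne1
  have hge : g < 12 * (σ.r P e / P.s) - 4 := by rw [Ge, nse] at hg; exact hg
  have hee : 2 * P.e ≤ σ.r P e := by zify; omega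
  obtain ⟨-, -, -, e1, e2⟩ := ringTube_bounds ne1 dve hee hge hve
  obtain ⟨hsec, hl1, hl2, hnorm⟩ := approach_bounds hV hσ hvb
  have hlv : σ.lv e ≠ σ.lv b := hR.2.1 e b heb
  have hμ0 : (0 : ℤ) ≤ P.μ := by positivity
  rcases lt_or_gt_of_ne hlv with hlt | hlt
  · have hle : (σ.lv e : ℤ) + 1 ≤ σ.lv b := by exact_mod_cast hlt
    have hkey : (2 * (σ.lv e : ℤ) + 1) * P.μ + 2 * P.μ ≤ (2 * (σ.lv b : ℤ) + 1) * P.μ := by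
      rw [show (2 * (σ.lv e : ℤ) + 1) * P.μ + 2 * P.μ = (2 * (σ.lv e : ℤ) + 3) * P.μ by ring]
      exact mul_le_mul_of_nonneg_right (by linarith) hμ0
    omega
  · -- the approach tube of `b` crosses the ring of `e` off the arc
    have hwin := hR.2.2.2.2.2.1 e b hcol hlt
    have hN4 : (P.N' : ℤ) = 4 * P.M := by exact_mod_cast hV.facts.2.2.2.2.2.2.2.2.2.2.2.2.1
    have htr : -(σ.r P e : ℤ) ≤ σ.t P b := by omega
    have hιA : 1 ≤ latIdx P.s (σ.r P e) (σ.t P b) := le_latIdx_of_le (m := 1) (by omega) (by push_cast; omega)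
    have hιB : latIdx P.s (σ.r P e) (σ.t P b + (P.N' / 64 : ℕ)) + 2 < σ.nr P e :=
      latIdx_add_lt (m := 2) (by omega) nse' (by omega) (by push_cast; rw [hN4]; omega)
    rw [nse] at hιB
    have hout : g < min (piecePos (σ.r P e / P.s) (ts b) (latIdx P.s (σ.r P e) (σ.t P b) - 1))
          (piecePos (σ.r P e / P.s) (ts b) (latIdx P.s (σ.r P e) (σ.t P b + (P.N' / 64 : ℕ)) + 1)) ∨
        max (piecePos (σ.r P e / P.s) (ts b) (latIdx P.s (σ.r P e) (σ.t P b) - 1))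
          (piecePos (σ.r P e / P.s) (ts b) (latIdx P.s (σ.r P e) (σ.t P b + (P.N' / 64 : ℕ)) + 1)) + 1 < g := by
      by_contra hc
      push Not at hc
      have hlo : σ.apprWinLo P b e ≤ g ∧ g ≤ σ.apprWinHi P b e := by
        unfold Slot4.apprWinLo Slot4.apprWinHi; rw [nse]; exact ⟨hc.1, hc.2⟩
      exact hwin g (by rw [nse]; omega) hlo.1 hlo.2 hin
    exact Set.disjoint_left.1 (ringTube_disjoint_of_lat rfl ne1 dve hee (d := 0) (by omega) hge (ts_lt b) htr (by omega) hιA (by omega)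
      hout (lam := (P.M : ℤ) / 8) (by omega) (fun x hx => (approach_bounds hV hσ hx).1)
      (fun x hx => by
        obtain ⟨-, q1, q2, -⟩ := approach_bounds hV hσ hx
        simp only [Nat.cast_zero, sub_zero, add_zero]
        exact ⟨q1, q2⟩)) hve hvb

/-- **Rings lie below every target box** (norm `≤ r + 2e ≤ 4M`). [folklore] -/
theorem arc_tgt_false (hV : P.Valid) (hσ : σ.InRange P) {e b : Fin 4}
    {g : ℕ} (hg : g < σ.G P e) {v : Site 2} (hve : v ∈ (ringTube (σ.r P e) P.e P.s g).box)
    (hvb : v ∈ frameIso (ts b) '' triStrip ((P.N' : ℤ) + 1) (σ.t P b - (P.N' / 64 : ℕ)) (P.N' / 16 - 1) (2 * (P.N' / 64))) : False := by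
  obtain ⟨hs, hk₀, hμ, hw1, hw2, he1, he2, hε1, hε2, -, -, -, -, -, -, hN, -, -, hn, hμM, hR₀, hR₀M, -⟩ := hV.ifacts
  obtain ⟨-, -, re1, re2, -, -, re5, -, ne1, nse, Ge, dve, -, hμe, -⟩ := arm_facts hV hσ e
  rw [nse] at ne1
  have hge : g < 12 * (σ.r P e / P.s) - 4 := by rw [Ge, nse] at hg; exact hg
  obtain ⟨-, -, -, e1, e2⟩ := ringTube_bounds ne1 dve (by zify; omega) hge hve
  obtain ⟨-, -, -, hnorm⟩ := target_bounds hV hσ hvb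
  omega

/-- **Approach and target boxes of distinct arms lie in distinct sectors.** [folklore] -/
theorem far_far_false (hV : P.Valid) (hσ : σ.InRange P) {e b : Fin 4} (heb : e ≠ b) {v : Site 2}
    (hve : v ∈ frameIso (ts e) '' triStrip ((σ.r P e : ℤ) - 2 * P.e) (σ.t P e) (σ.W P e) (P.N' / 64) ∨
      v ∈ frameIso (ts e) '' triStrip ((P.N' : ℤ) + 1) (σ.t P e - (P.N' / 64 : ℕ)) (P.N' / 16 - 1) (2 * (P.N' / 64)))
    (hvb : v ∈ frameIso (ts b) '' triStrip ((σ.r P b : ℤ) - 2 * P.e) (σ.t P b) (σ.W P b) (P.N' / 64) ∨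
      v ∈ frameIso (ts b) '' triStrip ((P.N' : ℤ) + 1) (σ.t P b - (P.N' / 64 : ℕ)) (P.N' / 16 - 1) (2 * (P.N' / 64))) : False := by
  have hM : (0 : ℤ) < (P.M : ℤ) / 8 := by
    have := hV.ifacts.2.2.2.2.2.2.2.2.2.2.2.2.2.2.2.2.2.2.2.1; have := hV.ifacts.2.2.1; have := hV.ifacts.2.1; omega
  have hse : v ∈ sectorNear (ts e) ((P.M : ℤ) / 8) := by
    rcases hve with h | h
    · exact (approach_bounds hV hσ h).1
    · exact (target_bounds hV hσ h).1
  have hsb : v ∈ sectorNear (ts b) ((P.M : ℤ) / 8) := by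
    rcases hvb with h | h
    · exact (approach_bounds hV hσ h).1
    · exact (target_bounds hV hσ h).1
  exact Set.disjoint_left.1 (disjoint_sectorNear (ts_lt e) (ts_lt b) (ts_ne_of_ne heb) (by omega)) hse hsb

/-! ### The supports are pairwise disjoint -/

/-- **The private support of an open arm is disjoint from that of a closed arm** (valid rung, slot in
range and admissible, routing predicate). [cite: Nolin2008, §4.3 Lemma 13 (arXiv 0711.4948: Lemma 12, `𝒜⁺ ∩ 𝒜⁻ = ∅`)] -/
theorem disjoint_privE (hV : P.Valid) (hσ : σ.InRange P) (hadm : σ.Adm P) (hR : RouteOK P σ) {e b : Fin 4} (hcol : col e ≠ col b) :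
    Disjoint (σ.privE P e) (σ.privE P b) := by
  have heb : e ≠ b := fun h => hcol (by rw [h])
  rw [Finset.disjoint_left]
  intro v hve hvb
  have hve' := mem_privE_cases hV hσ hR (Finset.mem_coe.2 hve)
  have hvb' := mem_privE_cases hV hσ hR (Finset.mem_coe.2 hvb)
  rcases hve' with hve' | ⟨g, hg, hin, hve'⟩ | hve' | hve'
  · rcases hvb' with hvb' | ⟨g', hg', hin', hvb'⟩ | hvb' | hvb'
    · exact near_near_false hV hσ hadm hR hcol hve' hvb'
    · exact near_arc_false hV hσ hadm hR hcol heb hve' hg' hin' hvb'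
    · exact near_appr_false hV hσ hadm hR hcol hve' hvb'
    · exact near_tgt_false hV hσ hadm hve' hvb'
  · rcases hvb' with hvb' | ⟨g', hg', hin', hvb'⟩ | hvb' | hvb'
    · exact near_arc_false hV hσ hadm hR hcol.symm heb.symm hvb' hg hin hve'
    · exact arc_arc_false hV hσ hR heb hg hve' hg' hvb'
    · exact arc_appr_false hV hσ hR hcol heb hg hin hve' hvb'
    · exact arc_tgt_false hV hσ hg hve' hvb'
  · rcases hvb' with hvb' | ⟨g', hg', hin', hvb'⟩ | hvb' | hvb'
    · exact near_appr_false hV hσ hadm hR hcol.symm hvb' hve'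
    · exact arc_appr_false hV hσ hR hcol.symm heb.symm hg' hin' hvb' hve'
    · exact far_far_false hV hσ heb (Or.inl hve') (Or.inl hvb')
    · exact far_far_false hV hσ heb (Or.inl hve') (Or.inr hvb')
  · rcases hvb' with hvb' | ⟨g', hg', hin', hvb'⟩ | hvb' | hvb'
    · exact near_tgt_false hV hσ hadm hvb' hve'
    · exact arc_tgt_false hV hσ hg' hvb' hve'
    · exact far_far_false hV hσ heb (Or.inr hve') (Or.inl hvb')
    · exact far_far_false hV hσ heb (Or.inr hve') (Or.inr hvb')

/-- **Every private support lies beyond `Λ_{2M}`, off the shared support.** [cite: Nolin2008, §4.3 Lemma 13 (arXiv 0711.4948: Lemma 12, `𝒜 ∩ 𝒜^± = ∅`)] -/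
theorem disjoint_osharedFin_privE (hV : P.Valid) (hσ : σ.InRange P) (hadm : σ.Adm P) (hR : RouteOK P σ) (e : Fin 4) :
    Disjoint (osharedFin P.n P.M) (σ.privE P e) := by
  obtain ⟨hs, hk₀, hμ, hw1, hw2, he1, he2, hε1, hε2, -, -, -, -, -, -, hN, -, -, hn, hμM, hR₀, hR₀M, -⟩ := hV.ifacts
  obtain ⟨ke1, ke2, re1, re2, -, -, -, Le, ne1, nse, Ge, dve, -, hμe, -⟩ := arm_facts hV hσ e
  obtain ⟨ha1, ha2⟩ := hadm e
  rw [Finset.disjoint_left]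
  intro v hvs hve
  rw [mem_osharedFin] at hvs
  rcases mem_privE_cases hV hσ hR (Finset.mem_coe.2 hve) with h | ⟨g, hg, -, h⟩ | h | h
  · have := norm_of_mem_onearSet (hσ.hfr e) (k := σ.k P e) (ε := P.ε) (L := σ.L P e) (T₀ := σ.T P e) (w := P.w) (M := P.M)
      (by omega) (by omega) (by zify; rw [Le]; omega) (by omega) (by omega) h
    omega
  · rw [nse] at ne1
    have hge : g < 12 * (σ.r P e / P.s) - 4 := by rw [Ge, nse] at hg; exact hg
    obtain ⟨-, -, -, e1, -⟩ := ringTube_bounds ne1 dve (by zify; omega) hge h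
    omega
  · have := (approach_bounds hV hσ h).2.2.2
    omega
  · have := (target_bounds hV hσ h).2.2.2
    omega

end Slot4

end Literature.Probability.Percolation
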